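import Summits.QuantumFields.YangMills.Theorems.IR.EsPolymerGasMixingK
import Summits.QuantumFields.YangMills.Theorems.IR.EsPolymerGridCellsK
import Summits.QuantumFields.YangMills.Theorems.IR.EsPolymerDefsK
import Literature.MathematicalPhysics.QuantumLattice.LatticeGaugeDLRCovarianceSplit

/-!
# Crux `IR` (item stmt-QuantumFields-19354) — line «es-polymer-decoupling»: the ENGINE stub
# `stub_polymerEngineK : PolymerEngineK`, proved

Helper module for item `stmt-QuantumFields-19354` (`--supports … --as helper`; it closes nothing: it proves the
statement `PolymerEngineK` of `Theorems/IR/EsPolymerDefsK.lean`, which is the type of the open ENGINE stub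
`stub_polymerEngineK` of the lead's registered skeleton `Cruxes/IR/Lines/es_polymer_decoupling.lean` v4 — generic
probability / combinatorics, no Yang–Mills content; IDEATOR seat ym-ir-idea-1 g7, RULING g9-№2).

`PolymerEngineK`: there is an absolute `p₀ > 0` such that, for every compact group `G`, representation `r`, unit
`a(β) → 0⁺`: a disjoint-polymer representation of the torus Wilson states with activities `≤ p₀^{|γ|}` on a mesh
`b = ⌈ℓ / a(β)⌉` refining in lattice units (`DPRkInUnits r a p₀`, clauses (I)_k (D)_k at every collar width `k`)
implies the mass gap in physical units `GapInUnits G r a` (clustering `C e^{-c₁ a(β) n}` of every pair of species,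
`c₁` uniform).  PROOF (inputs (a)–(d) of the lead's list, all in the tree):
* take `p₀ = (4 M²)⁻²`, `M = 13⁴ + 1`, so `θ := 2 √p₀ = (2 M²)⁻¹` meets the Peierls smallness `M² θ ≤ 1/2`;
* given species `A, B` put `k := max` of the sup-radii of their supports; on the torus of side `2S+1` with the grid
  `w` handed out by `DPRk`, the lifted `A` depends on the radius-`k` block about the cell `c_A` of `0` and the lifted,
  time-translated `B` on the radius-`k` block about the cell `c_B` of `n • e₀`, and `n + 1 ≤ 2b (cellDist c_A c_B + 1)`
  (`Theorems/IR/EsPolymerGridCellsK.lean`, input (d));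
* ENGINE REGIME `cellDist c_A c_B ≥ 2k + 2`: clauses (I)_k, (D)_k feed the two-region mixing bound
  `GasMixing.abs_blockCov_le_pow` (`Theorems/IR/EsPolymerGasMixingK.lean`, inputs (a)–(c)):
  `|Cov| ≤ 8 C_A C_B (2k+3)⁴ θ^{(d-2k-2)/6+2}`, and `θ^{(d-2k-2)/6+2} ≤ e^{k L/3} e^{-c₁ a(β) n}` with `L = log (2M²)`,
  `c₁ := L / (12 (ℓ + 1))`, using `a(β) b ≤ ℓ + 1` for `β` large (`a(β) ≤ 1`);
* SHORT REGIME `cellDist < 2k + 2`: then `a(β) n ≤ 2 (ℓ+1)(2k+2)` and the trivial bound `|Cov| ≤ 2 C_A C_B` is absorbed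
  into the constant; translation invariance of the torus state (`integral_comp_configShift_torusLift`) identifies
  the untranslated mean of `B` in `latticeConnectedCorr` with the translated one.
HONEST FRAMING: this closes the ENGINE stub only; the line's load-bearing stub `stub_polymerCertK : IRPolymerCertK`
(the weak-coupling polymer representation of 4-d lattice Yang–Mills at scale `ℓ/a(β)`, XL, literature-open at weak
coupling) is untouched, so neither `BalabanLadder.IR` nor any lattice mass gap is proved here, let alone the Clay
Yang–Mills problem; R4 closes only the conditional finite-volume rung `BalabanLadder.UV`.
-/

set_option autoImplicit false

noncomputable section

open Filter Topology MeasureTheory Finset Function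
open Literature.MathematicalPhysics.QuantumFieldTheory
open Literature.MathematicalPhysics.QuantumLattice (LGConfig torusEdge torusLift configShift IsCylinder
  integral_comp_configShift_torusLift)
open Summit.QuantumFields.YangMills.Cruxes.OSLegsFromFemtoAndGap.DlrCollarTransfer (GapInUnits)
open Summit.QuantumFields.YangMills.Cruxes.IR.EsPolymer.GridCells
open Summit.QuantumFields.YangMills.Cruxes.IR.EsPolymer.GasMixing (abs_blockCov_le_pow)

namespace Summit.QuantumFields.YangMills.Cruxes.IR.EsPolymer.EngineK

/-- A bounded function has a bounded integral against a probability measure. -/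
theorem abs_integral_le_of_abs_le {Ω : Type} [MeasurableSpace Ω] (μ : Measure Ω) [IsProbabilityMeasure μ]
    {f : Ω → ℝ} {C : ℝ} (h : ∀ x, |f x| ≤ C) : |∫ x, f x ∂μ| ≤ C := by
  have h1 := norm_integral_le_of_norm_le_const (μ := μ) (f := f) (C := C)
    (Filter.Eventually.of_forall fun x => by rw [Real.norm_eq_abs]; exact h x)
  simpa [Real.norm_eq_abs, measure_univ] using h1

/-- The precomposition `torusLift N` is measurable (product σ-algebras; no countability needed). -/
theorem measurable_torusLift' {G : Type} [MeasurableSpace G] (N : ℕ) :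
    Measurable (torusLift (d := 4) (G := G) N) :=
  measurable_pi_lambda _ fun e => measurable_pi_apply (torusEdge N e)
set_option maxHeartbeats 400000 in
/-- **The engine stub of line «es-polymer-decoupling»: `PolymerEngineK` holds** (with `p₀ = (4 (13⁴+1)²)⁻²`). -/
theorem polymerEngineK : PolymerEngineK := by
  set M : ℝ := (13 : ℝ) ^ 4 + 1 with hM
  have hM1 : 1 < M := by rw [hM]; norm_num
  have hM0 : 0 < M := by linarith
  unfold PolymerEngineK
  refine ⟨((4 * M ^ 2)⁻¹) ^ 2, by positivity, ?_⟩
  intro G _ _ _ _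
  letI : MeasurableSpace G := borel G
  haveI : BorelSpace G := ⟨rfl⟩
  intro r a ha ha0 hD
  obtain ⟨ℓ, β₂, S₁, hℓ, hD⟩ := hD
  -- eventually `a β ≤ 1`
  obtain ⟨βa, hβa⟩ : ∃ βa : ℝ, ∀ β, βa ≤ β → a β ≤ 1 := by
    obtain ⟨βa, h⟩ := Filter.mem_atTop_sets.1 (ha0 (Iic_mem_nhds zero_lt_one))
    exact ⟨βa, fun β hβ => h β hβ⟩
  -- constants
  set Lθ : ℝ := Real.log (2 * M ^ 2) with hLθ
  have h2M : 1 < 2 * M ^ 2 := by nlinarith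
  have hLθ0 : 0 < Lθ := Real.log_pos h2M
  have hθexp : Real.exp (-Lθ) = (2 * M ^ 2)⁻¹ := by
    rw [hLθ, ← Real.log_inv]; exact Real.exp_log (by positivity)
  set c₁ : ℝ := Lθ / (12 * (ℓ + 1)) with hc₁
  have hc₁0 : 0 < c₁ := by positivity
  unfold GapInUnits
  refine ⟨c₁, max β₂ βa, S₁, hc₁0, ?_⟩
  intro A B
  obtain ⟨CA, hCA⟩ := A.bounded
  obtain ⟨CB, hCB⟩ := B.bounded
  have hCA0 : 0 ≤ CA := (abs_nonneg _).trans (hCA fun _ => 1)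
  have hCB0 : 0 ≤ CB := (abs_nonneg _).trans (hCB fun _ => 1)
  set k : ℕ := max (suppRadius A.supp) (suppRadius B.supp) with hk
  set C₁ : ℝ := 8 * CA * CB * ((2 * k + 3 : ℕ) : ℝ) ^ 4 * Real.exp (k * Lθ / 3) with hC₁
  set C₂ : ℝ := 2 * CA * CB * Real.exp (c₁ * (2 * (ℓ + 1) * (2 * k + 2))) with hC₂
  have hC₁0 : 0 ≤ C₁ := by positivity
  have hC₂0 : 0 ≤ C₂ := by positivity
  refine ⟨C₁ + C₂, ?_⟩
  intro β hβ S n hS hn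
  have hβ2 : β₂ ≤ β := le_of_max_le_left hβ
  have haβ1 : a β ≤ 1 := hβa β (le_of_max_le_right hβ)
  have haβ : 0 < a β := ha β
  obtain ⟨q, w, hg, act, Z, ν, hZ, hact, hν0, hsum, hmass, hI, hDk⟩ := hD β hβ2 S hS
  haveI : NeZero q := ⟨(hg.1).ne'⟩
  haveI : Nonempty G := ⟨1⟩
  -- the mesh `b = ⌈ℓ / a β⌉₊ ≥ 1` and `a β · b ≤ ℓ + 1`
  set b : ℕ := ⌈ℓ / a β⌉₊ with hb
  have hb1 : 1 ≤ b := Nat.one_le_iff_ne_zero.2 (Nat.ceil_pos.2 (div_pos hℓ haβ)).ne'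
  have hbℓ : a β * b ≤ ℓ + 1 := by
    have h1 : (b : ℝ) < ℓ / a β + 1 := Nat.ceil_lt_add_one (by positivity)
    calc a β * b ≤ a β * (ℓ / a β + 1) := mul_le_mul_of_nonneg_left h1.le haβ.le
      _ = ℓ + a β := by field_simp
      _ ≤ ℓ + 1 := by linarith
  -- the torus Wilson state and the two observables
  haveI : IsProbabilityMeasure (wilsonMeasure (d := 4) (L := 2 * S + 1) r.ρ β) :=
    isProbabilityMeasure_wilsonMeasure (d := 4) (L := 2 * S + 1) r.ρ r.continuous β
  set A' : GaugeConfig 4 (2 * S + 1) G → ℝ := fun U => A.F (torusLift (2 * S + 1) U) with hA'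
  set B' : GaugeConfig 4 (2 * S + 1) G → ℝ :=
    fun U => B.F (configShift (-Pi.single 0 (n : ℤ)) (torusLift (2 * S + 1) U)) with hB'
  have hAm : Measurable A' := A.measurable.comp (measurable_torusLift' (2 * S + 1))
  have hBm : Measurable B' :=
    B.measurable.comp ((configShift _).measurable.comp (measurable_torusLift' (2 * S + 1)))
  have hA : ∀ U, |A' U| ≤ CA := fun U => hCA _
  have hB : ∀ U, |B' U| ≤ CB := fun U => hCB _
  -- cells of the two supports
  set cA : Cell q := cellOf q w 0 with hcA
  set cB : Cell q := cellOf q w (Pi.single 0 (n : ℤ)) with hcB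
  have hdepA : DependsOn A' (blockEdges (2 * S + 1) q w cA k) :=
    dependsOn_blockEdges hg hb1 A.isCylinder (le_max_left _ _)
  have hdepB : DependsOn B' (blockEdges (2 * S + 1) q w cB k) :=
    dependsOn_blockEdges_shift hg hb1 B.isCylinder (le_max_right _ _) _
  have hlow : (n : ℤ) + 1 ≤ 2 * (b : ℤ) * (cellDist cA cB + 1) := succ_le_mul_cellDist hg hb1 hn
  have hlowR : (n : ℝ) + 1 ≤ 2 * (b : ℝ) * ((cellDist cA cB : ℝ) + 1) := by exact_mod_cast hlow
  -- the connected correlation is the covariance of `A'`, `B'` (translation invariance for the mean of `B`)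
  have hmeanB := (integral_comp_configShift_torusLift (S := 2 * S + 1) r.ρ β B.F (-Pi.single 0 (n : ℤ))).symm
  have hcorr : latticeConnectedCorr r.ρ β (2 * S + 1) A.F B.F n =
      (∫ U, A' U * B' U ∂(wilsonMeasure (d := 4) (L := 2 * S + 1) r.ρ β)) -
        (∫ U, A' U ∂(wilsonMeasure (d := 4) (L := 2 * S + 1) r.ρ β)) *
          (∫ U, B' U ∂(wilsonMeasure (d := 4) (L := 2 * S + 1) r.ρ β)) := by
    unfold latticeConnectedCorr
    rw [hmeanB]
  rw [hcorr]
  have hexp0 : 0 < Real.exp (-(c₁ * a β * n)) := Real.exp_pos _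
  by_cases hreg : 2 * k + 2 ≤ cellDist cA cB
  · /- ENGINE REGIME -/
    obtain ⟨ΦA, hΦA⟩ := hDk k cA A' hAm ⟨CA, hA⟩ hdepA
    obtain ⟨ΦB, hΦB⟩ := hDk k cB B' hBm ⟨CB, hB⟩ hdepB
    have hIk : ∀ Γ, Compatible Γ → Disjoint (nearFamily Γ cA k) (nearFamily Γ cB k) →
        (ν Γ Set.univ).toReal * ∫ U, A' U * B' U ∂(ν Γ) = (∫ U, A' U ∂(ν Γ)) * (∫ U, B' U ∂(ν Γ)) :=
      fun Γ hΓ hdis => hI Γ hΓ k cA cB A' B' hAm hBm ⟨CA, hA⟩ ⟨CB, hB⟩ hdepA hdepB hreg hdis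
    have hsq : Real.sqrt (((4 * M ^ 2)⁻¹) ^ 2) = (4 * M ^ 2)⁻¹ := Real.sqrt_sq (by positivity)
    have hsmall : ((13 : ℝ) ^ 4 + 1) ^ 2 * (2 * Real.sqrt (((4 * M ^ 2)⁻¹) ^ 2)) ≤ 1 / 2 := by
      rw [hsq, ← hM]
      have : M ^ 2 * (2 * (4 * M ^ 2)⁻¹) = 1 / 2 := by field_simp; ring
      exact this.le
    have hbd := abs_blockCov_le_pow ν (wilsonMeasure (d := 4) (L := 2 * S + 1) r.ρ β) hsum hν0 hAm hBm hA hB k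
      cA cB act (fun γ => (hact γ).1) hmass (by positivity) (fun γ => (hact γ).2) hsmall hIk ΦA ΦB hΦA hΦB
    have hθ : (2 * Real.sqrt (((4 * M ^ 2)⁻¹) ^ 2) : ℝ) = (2 * M ^ 2)⁻¹ := by rw [hsq]; field_simp; ring
    rw [hθ] at hbd
    set d : ℕ := cellDist cA cB with hd
    set e : ℕ := (d - (2 * k + 2)) / 6 + 2 with he
    have he6 : (d : ℝ) + 1 ≤ 6 * (e : ℝ) + 2 * k := by
      have : d + 1 ≤ 6 * e + 2 * k := by omega
      exact_mod_cast this
    have hpow : ((2 * M ^ 2)⁻¹ : ℝ) ^ e = Real.exp (-(e * Lθ)) := by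
      rw [← hθexp, ← Real.exp_nat_mul]; congr 1; ring
    -- the exponent bookkeeping `c₁ a(β) n ≤ e L + k L / 3`
    have key : c₁ * a β * n ≤ e * Lθ + k * Lθ / 3 := by
      have hn' : (n : ℝ) ≤ 2 * b * ((d : ℝ) + 1) := by linarith
      calc c₁ * a β * n ≤ c₁ * a β * (2 * b * ((d : ℝ) + 1)) := by gcongr
        _ = Lθ / (12 * (ℓ + 1)) * (a β * b) * (2 * ((d : ℝ) + 1)) := by rw [hc₁]; ring
        _ ≤ Lθ / (12 * (ℓ + 1)) * (ℓ + 1) * (2 * ((d : ℝ) + 1)) := by gcongr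
        _ = Lθ * ((d : ℝ) + 1) / 6 := by field_simp; ring
        _ ≤ Lθ * (6 * (e : ℝ) + 2 * k) / 6 := by gcongr
        _ = e * Lθ + k * Lθ / 3 := by ring
    have hexp : Real.exp (-(e * Lθ)) ≤ Real.exp (k * Lθ / 3) * Real.exp (-(c₁ * a β * n)) := by
      rw [← Real.exp_add]; exact Real.exp_le_exp.2 (by linarith)
    calc |(∫ U, A' U * B' U ∂(wilsonMeasure (d := 4) (L := 2 * S + 1) r.ρ β)) -
            (∫ U, A' U ∂(wilsonMeasure (d := 4) (L := 2 * S + 1) r.ρ β)) *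
              (∫ U, B' U ∂(wilsonMeasure (d := 4) (L := 2 * S + 1) r.ρ β))|
          ≤ 8 * CA * CB * ((2 * k + 3 : ℕ) : ℝ) ^ 4 * ((2 * M ^ 2)⁻¹) ^ e := hbd
      _ = 8 * CA * CB * ((2 * k + 3 : ℕ) : ℝ) ^ 4 * Real.exp (-(e * Lθ)) := by rw [hpow]
      _ ≤ 8 * CA * CB * ((2 * k + 3 : ℕ) : ℝ) ^ 4 * (Real.exp (k * Lθ / 3) * Real.exp (-(c₁ * a β * n))) := by
          gcongr
      _ = C₁ * Real.exp (-(c₁ * a β * n)) := by rw [hC₁]; ring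
      _ ≤ (C₁ + C₂) * Real.exp (-(c₁ * a β * n)) := by gcongr; linarith
  · /- SHORT REGIME: trivial bound -/
    have hd : cellDist cA cB ≤ 2 * k + 1 := by omega
    have hnb : (n : ℝ) ≤ 2 * b * (2 * (k : ℝ) + 2) := by
      have : ((cellDist cA cB : ℕ) : ℝ) + 1 ≤ 2 * (k : ℝ) + 2 := by exact_mod_cast (by omega : cellDist cA cB + 1 ≤ 2 * k + 2)
      have h2b : (0 : ℝ) ≤ 2 * b := by positivity
      nlinarith
    have key : c₁ * a β * n ≤ c₁ * (2 * (ℓ + 1) * (2 * k + 2)) := by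
      have h1 : a β * n ≤ (a β * b) * (2 * (2 * (k : ℝ) + 2)) := by nlinarith
      have h2 : (a β * b) * (2 * (2 * (k : ℝ) + 2)) ≤ (ℓ + 1) * (2 * (2 * (k : ℝ) + 2)) :=
        mul_le_mul_of_nonneg_right hbℓ (by positivity)
      have h3 : c₁ * a β * n = c₁ * (a β * n) := by ring
      rw [h3]
      exact mul_le_mul_of_nonneg_left (by linarith) hc₁0.le
    have hone : (1 : ℝ) ≤ Real.exp (c₁ * (2 * (ℓ + 1) * (2 * k + 2))) * Real.exp (-(c₁ * a β * n)) := by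
      rw [← Real.exp_add]; exact Real.one_le_exp (by linarith)
    have hi1 := abs_integral_le_of_abs_le (wilsonMeasure (d := 4) (L := 2 * S + 1) r.ρ β)
      (f := fun U => A' U * B' U) (C := CA * CB)
      (fun U => by rw [abs_mul]; exact mul_le_mul (hA U) (hB U) (abs_nonneg _) hCA0)
    have hi2 := abs_integral_le_of_abs_le (wilsonMeasure (d := 4) (L := 2 * S + 1) r.ρ β) (f := A') hA
    have hi3 := abs_integral_le_of_abs_le (wilsonMeasure (d := 4) (L := 2 * S + 1) r.ρ β) (f := B') hB
    calc |(∫ U, A' U * B' U ∂(wilsonMeasure (d := 4) (L := 2 * S + 1) r.ρ β)) -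
            (∫ U, A' U ∂(wilsonMeasure (d := 4) (L := 2 * S + 1) r.ρ β)) *
              (∫ U, B' U ∂(wilsonMeasure (d := 4) (L := 2 * S + 1) r.ρ β))|
          ≤ |∫ U, A' U * B' U ∂(wilsonMeasure (d := 4) (L := 2 * S + 1) r.ρ β)| +
            |∫ U, A' U ∂(wilsonMeasure (d := 4) (L := 2 * S + 1) r.ρ β)| *
              |∫ U, B' U ∂(wilsonMeasure (d := 4) (L := 2 * S + 1) r.ρ β)| := by
          rw [← abs_mul]; exact abs_sub _ _
      _ ≤ CA * CB + CA * CB := by gcongr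
      _ = 2 * CA * CB * 1 := by ring
      _ ≤ 2 * CA * CB * (Real.exp (c₁ * (2 * (ℓ + 1) * (2 * k + 2))) * Real.exp (-(c₁ * a β * n))) := by
          gcongr
      _ = C₂ * Real.exp (-(c₁ * a β * n)) := by rw [hC₂]; ring
      _ ≤ (C₁ + C₂) * Real.exp (-(c₁ * a β * n)) := by gcongr; linarith

end Summit.QuantumFields.YangMills.Cruxes.IR.EsPolymer.EngineK

end
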